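import Mathlib

/-!
# Crux `ExactCertificate` (stmt-AtomisticToContinuum-11959), line `closure-makes-nogap-exact`,
# skeleton IX (`FarSlackActive`): stub `stub_sliceBridge` (F1)

Support file for the crux `ThreeConeCertificate.ExactCertificate`, skeleton IX
(`Cruxes.ExactCertificate.FarEqual`: the slack cone of an exact three-cone certificate is active
beyond every radius).  Skeleton IX computes the Fourier transform of an explicit radial tail kernel
on `ℝ³` along the first axis `e₀ = EuclideanSpace.single 0 1` by SLICING `ℝ³ = ℝ × ℝ²`: for an
integrable `G : ℝ³ → ℂ` the slice `s ↦ 𝓕 G (s • e₀)` is the one-dimensional Fourier transform of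
the "plank profile" `x ↦ ∫_{ℝ²} G (x, y) dy`, and the plank profile is integrable.  This is Fubini
along the volume-preserving measurable equivalence

  `ℝ³ ≃ᵐ ℝ × ℝ²`, `v ↦ (v₀, (v₁, v₂))`, inverse `(x, w) ↦ !₂[x, w 0, w 1]`

(Mathlib's `MeasurableEquiv.piFinSuccAbove` at the index `0`, conjugated by the identifications
`EuclideanSpace ℝ (Fin n) ≃ᵐ (Fin n → ℝ)`), together with
`⟪!₂[x, w 0, w 1], s • e₀⟫ = s x = ⟪x, s⟫_ℝ`, so that the character of the Fourier integrand
depends on the axial variable only and can be pulled out of the inner integral.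

Pure Mathlib (`EuclideanSpace.volume_preserving_symm_measurableEquiv_toLp`,
`volume_preserving_piFinSuccAbove`, `PiLp.volume_preserving_toLp`,
`MeasurePreserving.integrable_comp_emb`, `MeasurePreserving.integral_comp`, `integral_prod`,
`Integrable.integral_prod_left`, `Real.fourier_eq'`); private helper lemmas only, no named
facts.  All `[folklore]`.
-/

noncomputable section

namespace Summit.AtomisticToContinuum.Crystallization.Theorems.ThreeConeCertificateExactCertificate.FarEqual

open MeasureTheory
open scoped FourierTransform RealInnerProductSpace

/-- The axial splitting `ℝ³ ≃ᵐ ℝ × ℝ²`, `v ↦ (v₀, (v₁, v₂))`: a volume-preserving measurable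
equivalence whose inverse is `(x, w) ↦ !₂[x, w 0, w 1]` (`MeasurableEquiv.piFinSuccAbove` at the
index `0`, conjugated by the volume-preserving `EuclideanSpace ℝ (Fin n) ≃ᵐ (Fin n → ℝ)`).
[folklore] -/
private theorem exists_axialSplit :
    ∃ e : EuclideanSpace ℝ (Fin 3) ≃ᵐ ℝ × EuclideanSpace ℝ (Fin 2),
      MeasurePreserving e volume volume ∧
        ∀ (x : ℝ) (w : EuclideanSpace ℝ (Fin 2)), e.symm (x, w) = !₂[x, w 0, w 1] := by
  set e : EuclideanSpace ℝ (Fin 3) ≃ᵐ ℝ × EuclideanSpace ℝ (Fin 2) :=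
    ((MeasurableEquiv.toLp 2 (Fin 3 → ℝ)).symm.trans
      (MeasurableEquiv.piFinSuccAbove (fun _ => ℝ) 0)).trans
      (MeasurableEquiv.prodCongr (MeasurableEquiv.refl ℝ) (MeasurableEquiv.toLp 2 (Fin 2 → ℝ)))
    with he
  refine ⟨e, ?_, fun x w => ?_⟩
  · -- each of the three factors preserves Lebesgue measure
    have h1 : MeasurePreserving (MeasurableEquiv.toLp 2 (Fin 3 → ℝ)).symm volume volume :=
      EuclideanSpace.volume_preserving_symm_measurableEquiv_toLp (Fin 3)
    have h2 : MeasurePreserving (MeasurableEquiv.piFinSuccAbove (fun _ : Fin 3 => ℝ) 0) volume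
        volume :=
      volume_preserving_piFinSuccAbove (fun _ => ℝ) 0
    have h3 : MeasurePreserving
        (MeasurableEquiv.prodCongr (MeasurableEquiv.refl ℝ) (MeasurableEquiv.toLp 2 (Fin 2 → ℝ)))
        volume volume :=
      (MeasurePreserving.id volume).prod (PiLp.volume_preserving_toLp (Fin 2))
    exact (h1.trans h2).trans h3
  · -- the inverse in coordinates: `e !₂[x, w 0, w 1] = (x, w)` by computation
    apply e.injective
    rw [MeasurableEquiv.apply_symm_apply]
    refine Prod.ext rfl ?_
    ext j
    fin_cases j <;> rfl

/-- The phase along the first axis in the split variables: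
`⟪!₂[x, w 0, w 1], s • e₀⟫ = ⟪x, s⟫_ℝ` (both equal `s x`). [folklore] -/
private theorem inner_split_smul_single (s x : ℝ) (w : EuclideanSpace ℝ (Fin 2)) :
    ⟪(!₂[x, w 0, w 1] : EuclideanSpace ℝ (Fin 3)),
        s • EuclideanSpace.single (0 : Fin 3) (1 : ℝ)⟫ = ⟪x, s⟫ := by
  rw [real_inner_smul_right, EuclideanSpace.inner_single_right]
  simp

/-- Transport of integrability along the split: if `G : ℝ³ → ℂ` is integrable and `χ : ℝ → ℂ` is
continuous with `‖χ‖ ≤ 1`, then `(x, w) ↦ χ x · G !₂[x, w 0, w 1]` is integrable for the product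
measure on `ℝ × ℝ²` (it is `(v ↦ χ v₀ · G v) ∘ e.symm` for the volume-preserving split `e`).
[folklore] -/
private theorem integrable_twist_split {G : EuclideanSpace ℝ (Fin 3) → ℂ} (hG : Integrable G)
    {e : EuclideanSpace ℝ (Fin 3) ≃ᵐ ℝ × EuclideanSpace ℝ (Fin 2)}
    (he : MeasurePreserving e volume volume)
    (hsymm : ∀ (x : ℝ) (w : EuclideanSpace ℝ (Fin 2)), e.symm (x, w) = !₂[x, w 0, w 1])
    {χ : ℝ → ℂ} (hχ : Continuous χ) (hχ1 : ∀ x, ‖χ x‖ ≤ 1) :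
    Integrable (fun p : ℝ × EuclideanSpace ℝ (Fin 2) => χ p.1 * G !₂[p.1, p.2 0, p.2 1])
      ((volume : Measure ℝ).prod volume) := by
  have hK : Integrable (fun v : EuclideanSpace ℝ (Fin 3) => χ (v 0) * G v) := by
    refine Integrable.mono' hG.norm ?_ (ae_of_all _ fun v => ?_)
    · have hc : Continuous fun v : EuclideanSpace ℝ (Fin 3) => χ (v 0) :=
        hχ.comp (PiLp.continuous_apply 2 (fun _ : Fin 3 => ℝ) 0)
      exact hc.aestronglyMeasurable.mul hG.aestronglyMeasurable
    · rw [norm_mul]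
      exact mul_le_of_le_one_left (norm_nonneg _) (hχ1 _)
  have h := ((he.symm _).integrable_comp_emb e.symm.measurableEmbedding).2 hK
  refine h.congr (ae_of_all _ ?_)
  rintro ⟨x, w⟩
  simp only [Function.comp_apply, hsymm]
  rfl

/-- **Stub F1 (slicing `ℝ³ = ℝ × ℝ²`).**  For an integrable `G : ℝ³ → ℂ`, the plank profile
`x ↦ ∫_{ℝ²} G (x, y) dy` is integrable and the slice of `𝓕 G` along the first axis is its
one-dimensional Fourier transform: `𝓕 G (s • e₀) = 𝓕 (x ↦ ∫ G (x, y) dy) s` (Fubini along the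
volume-preserving split `v ↦ (v₀, (v₁, v₂))`, the character `exp (-2π i s v₀)` depending on the
axial variable only). [folklore] -/
theorem stub_sliceBridge : ∀ (G : EuclideanSpace ℝ (Fin 3) → ℂ), MeasureTheory.Integrable G →
      MeasureTheory.Integrable (fun x : ℝ => ∫ y : EuclideanSpace ℝ (Fin 2), G !₂[x, y 0, y 1]) ∧
        ∀ s : ℝ, 𝓕 G (s • EuclideanSpace.single (0 : Fin 3) (1 : ℝ)) =
          𝓕 (fun x : ℝ => ∫ y : EuclideanSpace ℝ (Fin 2), G !₂[x, y 0, y 1]) s := by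
  intro G hG
  obtain ⟨e, he, hsymm⟩ := exists_axialSplit
  have hes : MeasurePreserving e.symm volume volume := he.symm _
  refine ⟨?_, fun s => ?_⟩
  · -- the plank profile is the `x`-marginal of the integrable `G ∘ e.symm`
    have h1 := integrable_twist_split hG he hsymm (χ := fun _ => 1) continuous_const
      (fun _ => by simp)
    simp only [one_mul] at h1
    exact h1.integral_prod_left
  · -- Fubini for the Fourier integrand, whose character depends on `x` only
    set χ : ℝ → ℂ := fun x => Complex.exp (↑(-2 * Real.pi * ⟪x, s⟫) * Complex.I) with hχdef
    have hχc : Continuous χ := by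
      rw [hχdef]
      fun_prop
    have hχ1 : ∀ x, ‖χ x‖ ≤ 1 := fun x => (Complex.norm_exp_ofReal_mul_I _).le
    have hKe := integrable_twist_split hG he hsymm hχc hχ1
    calc 𝓕 G (s • EuclideanSpace.single (0 : Fin 3) (1 : ℝ))
        = ∫ p : ℝ × EuclideanSpace ℝ (Fin 2), χ p.1 * G !₂[p.1, p.2 0, p.2 1] := by
          rw [Real.fourier_eq', ← hes.integral_comp e.symm.measurableEmbedding]
          refine integral_congr_ae (ae_of_all _ ?_)
          rintro ⟨x, w⟩
          simp only
          rw [hsymm, inner_split_smul_single, smul_eq_mul]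
      _ = ∫ x : ℝ, ∫ w : EuclideanSpace ℝ (Fin 2), χ x * G !₂[x, w 0, w 1] := by
          rw [Measure.volume_eq_prod, integral_prod _ hKe]
      _ = ∫ x : ℝ, χ x * ∫ w : EuclideanSpace ℝ (Fin 2), G !₂[x, w 0, w 1] := by
          simp_rw [integral_const_mul]
      _ = 𝓕 (fun x : ℝ => ∫ y : EuclideanSpace ℝ (Fin 2), G !₂[x, y 0, y 1]) s := by
          rw [Real.fourier_eq']
          simp only [hχdef, smul_eq_mul]

end Summit.AtomisticToContinuum.Crystallization.Theorems.ThreeConeCertificateExactCertificate.FarEqual
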